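import Summits.HodgeConjecture.CorCM.B01.Transposition.HComp.RecordSystemConjRecip
import Summits.HodgeConjecture.CorCM.B01.Transposition.HComp.RecordSystemConjShimuraSet
import Literature.AlgebraicGeometry.ShimuraVarieties.UnitaryShimuraComplexFibreGalois
import HarnessLib

/-!
# Change of frame for Deligne's record systems: `(H, τ, T) ↦ (H, τ, T·u)`, `u ∈ U(2,1)` — SAME models

Cell `hodgecm-mathlib`, fan A, off-place half of `HLiu418` (director g1 HANDOFF §7 item (3); A-p08 STATUS 2026-08-28T04:2xZ
CLARIFICATION: on the I-4 route the two CHOSEN records `recordOf h V` (read at `ι₀ = conj ∘ ι₁` by B2) and `recordOf h V₀` sit at the SAME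
`(L, H, τ)` but at DIFFERENT Sylvester frames; row I-4 `canonicalModel_unique_printed` and B3 ✔ `RecordSystem.exists_descent` are
SAME-FRAME).  For a frame `T` of `H^τ` (`Tᴴ H^τ T = J`) and `u ∈ U(J) = U(2,1)` the matrix `T·u` is again a frame, and a record system read
at `(τ, T)` is re-read at `(τ, T·u)` with the SAME models: the only `T`-dependent clauses are the identification of complex points with
`Sh_K(ℂ) = U(H)(L⁺) \ 𝔹² × U(H)(𝔸_f)/K` (the ball being `U(H)(L⁺)`-space through `γ ↦ T⁻¹ γ^τ T`) — re-read through the ball automorphism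
`y ↦ u • y` (`(T u)⁻¹ γ^τ (T u) = u⁻¹ (T⁻¹ γ^τ T) u`) — and the frame vectors `T·(x,1)` of `hol`/`pieces`/special points, which change by the
non-zero scalar `(u·(y,1))₃` (✔ `BallModel.lift_act`, homogeneity ✔ `unif_smul`, the `hol` witness's own homogeneity clause).

* §1 `formCongr_mul_U21`, `ratToU21_frameChange`, `shimuraSetOfFrameChange u : Sh_K(ℂ)_{T·u} ≃ₜ Sh_K(ℂ)_T`, `[y, a] ↦ [u • y, a]` (`rfl` formulas);
* §2 `ComplexRecordSystem.frameChange Sc u` (Mc := Sc.Mc) with its point formula by `rfl`;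
* §3 `RecordSystem.exists_frameChange (R) (u) : ∃ R', R'.M = R.M` via ✔ `recordSystem_exists_of_descent` (`e := Iso.refl`), the special
  points moving by `isLinePoint_frameChange_iff : IsLinePoint L τ (T·u) v₃ y ↔ IsLinePoint L τ T v₃ (u • y)`.

KERNEL: definitions by explicit formula + theorems; no instance, no notation, no named fact, no `sorry`.  HC_CM is NOT proved here; HC_CM is
proved only modulo the 7 printed citations until rung 0 closes.

References: [Deligne1979ShimuraVarieties] 2.1.2–2.1.4, 2.2.5; [Milne2005ShimuraVarieties] Lemma 5.13 p. 57, Def. 12.5 p. 113, Def. 12.8 (62) p. 114.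
-/

set_option autoImplicit false

noncomputable section

open CategoryTheory AlgebraicGeometry NumberField IsDedekindDomain Matrix
open Literature.AlgebraicGeometry.Motives
open Literature.NumberTheory.Automorphic.Liu2021.AppendixC (C5.OpenCompactSubgroup C5.SmallLevel)

namespace Summit.HodgeConjecture.CorCM.Model.RecordSystemConj

open Limits Function MulAction Topology
open scoped Matrix
open Literature.AlgebraicGeometry.ShimuraVarieties Literature.AlgebraicGeometry.ShimuraVarieties.UnitaryCanonicalModel
open Literature.NumberTheory.Automorphic Literature.NumberTheory.Automorphic.UnitaryGroup
open Literature.NumberTheory.Automorphic.ShimuraDissection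
open Literature.Geometry.ComplexHyperbolic Literature.Geometry.ComplexHyperbolic.BallModel

/-! ## §1 The frame `T·u` and the Shimura set: `[y, a]_{T·u} ↦ [u • y, a]_T` -/

section ShimuraSetFrame

variable (L : Type) [Field L] (H : Matrix (Fin 3) (Fin 3) L) (τ : L →+* ℂ) (T : GL (Fin 3) ℂ)

/-- **`(T u)ᴴ H^τ (T u) = uᴴ J u = J`**: right-multiplying a frame by an element of `U(J) = U(2,1)` gives a frame. [folklore] -/
theorem formCongr_mul_U21 (hT : formCongr (starRingEnd ℂ) T (H.map τ) = BallModel.J) (u : U21) :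
    formCongr (starRingEnd ℂ) (T * (u : GL (Fin 3) ℂ)) (H.map τ) = BallModel.J := by
  have hT' := hT
  rw [formCongr_star] at hT' ⊢
  rw [Units.val_mul, Matrix.conjTranspose_mul]
  calc ((u : GL (Fin 3) ℂ) : Matrix (Fin 3) (Fin 3) ℂ)ᴴ * (T : Matrix (Fin 3) (Fin 3) ℂ)ᴴ * H.map τ *
        ((T : Matrix (Fin 3) (Fin 3) ℂ) * ((u : GL (Fin 3) ℂ) : Matrix (Fin 3) (Fin 3) ℂ))
      = ((u : GL (Fin 3) ℂ) : Matrix (Fin 3) (Fin 3) ℂ)ᴴ *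
          ((T : Matrix (Fin 3) (Fin 3) ℂ)ᴴ * H.map τ * (T : Matrix (Fin 3) (Fin 3) ℂ)) *
            ((u : GL (Fin 3) ℂ) : Matrix (Fin 3) (Fin 3) ℂ) := by
        simp only [Matrix.mul_assoc]
    _ = BallModel.J := by
        rw [hT']
        exact mat_mem u

/-- **Frame vectors under a change of frame**: `(T u)·(y,1) = (u·(y,1))₃ • T·(u • y, 1)`, a NON-ZERO multiple of the frame vector of
`u • y` (✔ `BallModel.lift_act`). [folklore] -/
theorem frame_mul_mulVec_lift (u : U21) (y : Ball) :
    (((T * (u : GL (Fin 3) ℂ) : GL (Fin 3) ℂ)) : Matrix (Fin 3) (Fin 3) ℂ) *ᵥ BallModel.lift y =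
      W3 u y 2 • ((T : Matrix (Fin 3) (Fin 3) ℂ) *ᵥ BallModel.lift (u • y)) := by
  rw [BallModel.smul_def, lift_act, Matrix.mulVec_smul, smul_smul, mul_inv_cancel₀ (W3_2_ne_zero u y), one_smul,
    Units.val_mul, ← Matrix.mulVec_mulVec]
  rfl

/-- **Special points under a change of frame**: `y` is a line point of `v₃` in the frame `T·u` iff `u • y` is one in the frame `T`
(`(T u)·(y,1) ∈ ℂˣ·T·(u•y, 1)`). [cite: Milne2005ShimuraVarieties, Def. 12.5 and Rem. 12.6 p. 113] -/
theorem isLinePoint_frameChange_iff (u : U21) (v₃ : Fin 3 → L) (y : Ball) :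
    IsLinePoint L τ (T * (u : GL (Fin 3) ℂ)) v₃ y ↔ IsLinePoint L τ T v₃ (u • y) := by
  constructor
  · rintro ⟨c, hc, hy⟩
    refine ⟨(W3 u y 2)⁻¹ * c, mul_ne_zero (inv_ne_zero (W3_2_ne_zero u y)) hc, ?_⟩
    rw [mul_smul, ← hy, frame_mul_mulVec_lift, smul_smul, inv_mul_cancel₀ (W3_2_ne_zero u y), one_smul]
  · rintro ⟨c, hc, hy⟩
    refine ⟨W3 u y 2 * c, mul_ne_zero (W3_2_ne_zero u y) hc, ?_⟩
    rw [frame_mul_mulVec_lift, hy, smul_smul]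

variable [NumberField L] [IsCMField L] (hT : formCongr (starRingEnd ℂ) T (H.map τ) = BallModel.J) (u : U21)

/-- **`(T u)⁻¹ γ^τ (T u) = u⁻¹ (T⁻¹ γ^τ T) u`**: the archimedean projection of `U(H)(L⁺)` in the frame `T·u` is the `u`-conjugate of the one
in the frame `T`. [folklore] -/
theorem ratToU21_frameChange (γ : rational (↥(maximalRealSubfield L)) L (IsCMField.complexConj L) 3 H) :
    ratToU21 L H τ (T * (u : GL (Fin 3) ℂ)) (formCongr_mul_U21 L H τ T hT u) γ = u⁻¹ * ratToU21 L H τ T hT γ * u := by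
  apply Subtype.ext
  change ((archProjU21EmbCM L H τ (T * (u : GL (Fin 3) ℂ)) (formCongr_mul_U21 L H τ T hT u)
      (rationalToArch (↥(maximalRealSubfield L)) L (IsCMField.complexConj L) 3 H γ) : U21) : GL (Fin 3) ℂ) =
    (u : GL (Fin 3) ℂ)⁻¹ * ((archProjU21EmbCM L H τ T hT
      (rationalToArch (↥(maximalRealSubfield L)) L (IsCMField.complexConj L) 3 H γ) : U21) : GL (Fin 3) ℂ) * (u : GL (Fin 3) ℂ)
  rw [coe_archProjU21EmbCM_rationalToArch, coe_archProjU21EmbCM_rationalToArch, _root_.mul_inv_rev]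
  simp only [mul_assoc]

/-- **Equivariance of `y ↦ u • y`** between the `U(H)(L⁺)`-ball through `(τ, T·u)` and through `(τ, T)`: `u • (γ •_{T·u} y) = γ •_T (u • y)`.
[folklore] -/
theorem smul_ratToU21_frameChange_smul (γ : rational (↥(maximalRealSubfield L)) L (IsCMField.complexConj L) 3 H) (y : Ball) :
    u • (ratToU21 L H τ (T * (u : GL (Fin 3) ℂ)) (formCongr_mul_U21 L H τ T hT u) γ • y) = ratToU21 L H τ T hT γ • (u • y) := by
  rw [ratToU21_frameChange, smul_smul, smul_smul, ← mul_assoc, ← mul_assoc, mul_inv_cancel, one_mul]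

/-- The ball factor `y ↦ u • y` between the `U(H)(L⁺)`-ball through `(τ, T·u)` and through `(τ, T)`. [folklore] -/
def ballFactorOfFrameChange :
    Through (ratToU21 L H τ (T * (u : GL (Fin 3) ℂ)) (formCongr_mul_U21 L H τ T hT u)) Ball ≃ₜ Through (ratToU21 L H τ T hT) Ball :=
  ((Through.mkHomeomorph (ratToU21 L H τ (T * (u : GL (Fin 3) ℂ)) (formCongr_mul_U21 L H τ T hT u)) Ball).symm.trans
      (Homeomorph.smul u)).trans
    (Through.mkHomeomorph (ratToU21 L H τ T hT) Ball)

variable (K : Subgroup ↥(finAdelic (↥(maximalRealSubfield L)) L (IsCMField.complexConj L) 3 H))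

/-- The product map `(y, aK) ↦ (u • y, aK)`. [folklore] -/
def pairOfFrameChange :
    Through (ratToU21 L H τ (T * (u : GL (Fin 3) ℂ)) (formCongr_mul_U21 L H τ T hT u)) Ball ×
        CosetSpace (rationalToFinAdelic (↥(maximalRealSubfield L)) L (IsCMField.complexConj L) 3 H) K ≃ₜ
      Through (ratToU21 L H τ T hT) Ball ×
        CosetSpace (rationalToFinAdelic (↥(maximalRealSubfield L)) L (IsCMField.complexConj L) 3 H) K :=
  (ballFactorOfFrameChange L H τ T hT u).prodCongr (Homeomorph.refl _)

/-- **Equivariance of `(y, aK) ↦ (u • y, aK)`** under `U(H)(L⁺)`. [folklore] -/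
theorem pairOfFrameChange_smul (γ : rational (↥(maximalRealSubfield L)) L (IsCMField.complexConj L) 3 H)
    (p : Through (ratToU21 L H τ (T * (u : GL (Fin 3) ℂ)) (formCongr_mul_U21 L H τ T hT u)) Ball ×
      CosetSpace (rationalToFinAdelic (↥(maximalRealSubfield L)) L (IsCMField.complexConj L) 3 H) K) :
    pairOfFrameChange L H τ T hT u K (γ • p) = (MulEquiv.refl _) γ • pairOfFrameChange L H τ T hT u K p := by
  obtain ⟨z, y⟩ := p
  rw [Prod.smul_mk, MulEquiv.refl_apply, Prod.smul_mk]
  refine Prod.ext ?_ rfl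
  change Through.mk _ Ball (u • (ratToU21 L H τ (T * (u : GL (Fin 3) ℂ)) (formCongr_mul_U21 L H τ T hT u) γ •
      (Through.mk (ratToU21 L H τ (T * (u : GL (Fin 3) ℂ)) (formCongr_mul_U21 L H τ T hT u)) Ball).symm z)) =
    γ • Through.mk _ Ball (u • (Through.mk (ratToU21 L H τ (T * (u : GL (Fin 3) ℂ)) (formCongr_mul_U21 L H τ T hT u)) Ball).symm z)
  rw [Through.smul_mk, smul_ratToU21_frameChange_smul]

/-- **The Shimura set under a change of frame**: `Sh_K(U(H), 𝔹²)(ℂ)` presented in the frame `T·u` and in the frame `T` are homeomorphic by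
`[y, aK] ↦ [u • y, aK]` (same group, same level). [cite: Milne2005ShimuraVarieties, Lemma 5.13 p. 57] -/
def shimuraSetOfFrameChange :
    ShimuraSet L H τ (T * (u : GL (Fin 3) ℂ)) (formCongr_mul_U21 L H τ T hT u) K ≃ₜ ShimuraSet L H τ T hT K :=
  orbitQuotientHomeomorphOfEquivariant (MulEquiv.refl _) (pairOfFrameChange L H τ T hT u K) (pairOfFrameChange_smul L H τ T hT u K)

/-- `shimuraSetOfFrameChange [y, aK] = [u • y, aK]`. [cite: Milne2005ShimuraVarieties, Lemma 5.13 p. 57] -/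
@[simp] theorem shimuraSetOfFrameChange_mk (y : Ball) (a : ↥(finAdelic (↥(maximalRealSubfield L)) L (IsCMField.complexConj L) 3 H)) :
    shimuraSetOfFrameChange L H τ T hT u K (ShimuraSet.mk L H τ (T * (u : GL (Fin 3) ℂ)) (formCongr_mul_U21 L H τ T hT u) K y a) =
      ShimuraSet.mk L H τ T hT K (u • y) a :=
  rfl

/-- `shimuraSetOfFrameChange⁻¹ [x, aK] = [u⁻¹ • x, aK]`. [cite: Milne2005ShimuraVarieties, Lemma 5.13 p. 57] -/
@[simp] theorem shimuraSetOfFrameChange_symm_mk (x : Ball)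
    (a : ↥(finAdelic (↥(maximalRealSubfield L)) L (IsCMField.complexConj L) 3 H)) :
    (shimuraSetOfFrameChange L H τ T hT u K).symm (ShimuraSet.mk L H τ T hT K x a) =
      ShimuraSet.mk L H τ (T * (u : GL (Fin 3) ℂ)) (formCongr_mul_U21 L H τ T hT u) K (u⁻¹ • x) a :=
  rfl

end ShimuraSetFrame

/-! ## §2 The complex record system in the frame `T·u`: SAME complex models -/

section ComplexFrame

variable {L : Type} [Field L] [NumberField L] [IsCMField L] {H : Matrix (Fin 3) (Fin 3) L}
  {τ : L →+* ℂ} {T : GL (Fin 3) ℂ} {hT : formCongr (starRingEnd ℂ) T (H.map τ) = BallModel.J}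
  {K₀ : C5.OpenCompactSubgroup ↥(finAdelic (↥(maximalRealSubfield L)) L (IsCMField.complexConj L) 3 H)}

/-- The points identification in the frame `T·u`: `Mc_K(ℂ) ≃ₜ Sh_K(ℂ)_T ≃ₜ Sh_K(ℂ)_{T·u}` (`Sc.pts K`, then `[x, a] ↦ [u⁻¹ • x, a]`).
[cite: Milne2005ShimuraVarieties, Lemma 5.13 p. 57] -/
def frameChangePts (Sc : ComplexRecordSystem L H τ T hT K₀) (u : U21) (K : C5.SmallLevel K₀) :
    ComplexPoints (Sc.Mc.obj K) ≃ₜ ShimuraSet L H τ (T * (u : GL (Fin 3) ℂ)) (formCongr_mul_U21 L H τ T hT u) K.1.1 :=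
  (Sc.pts K).trans (shimuraSetOfFrameChange L H τ T hT u K.1.1).symm

/-- **Point formula, by `rfl`**: `(frameChangePts)⁻¹ [y, aK]_{T·u} = (Sc.pts K)⁻¹ [u • y, aK]_T`. [cite: Milne2005ShimuraVarieties, Lemma 5.13 p. 57] -/
theorem frameChangePts_symm_mk (Sc : ComplexRecordSystem L H τ T hT K₀) (u : U21) (K : C5.SmallLevel K₀) (y : Ball)
    (a : finAdelic (↥(maximalRealSubfield L)) L (IsCMField.complexConj L) 3 H) :
    (frameChangePts Sc u K).symm (ShimuraSet.mk L H τ (T * (u : GL (Fin 3) ℂ)) (formCongr_mul_U21 L H τ T hT u) K.1.1 y a) =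
      (Sc.pts K).symm (ShimuraSet.mk L H τ T hT K.1.1 (u • y) a) :=
  rfl

/-- `frameChangePts P = [u⁻¹ • x, aK]` when `Sc.pts K P = [x, aK]` (unfolding). [cite: Milne2005ShimuraVarieties, Lemma 5.13 p. 57] -/
theorem frameChangePts_apply (Sc : ComplexRecordSystem L H τ T hT K₀) (u : U21) (K : C5.SmallLevel K₀)
    (P : ComplexPoints (Sc.Mc.obj K)) :
    frameChangePts Sc u K P = (shimuraSetOfFrameChange L H τ T hT u K.1.1).symm (Sc.pts K P) :=
  rfl

/-- (C2a) in the frame `T·u`: the transitions act as `[y, aK₁] ↦ [y, aK₂]`. [cite: Deligne1979ShimuraVarieties, 2.1.4] -/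
theorem frameChangePts_map_pts (Sc : ComplexRecordSystem L H τ T hT K₀) (u : U21) (K₁ K₂ : C5.SmallLevel K₀) (f : K₁ ⟶ K₂)
    (y : Ball) (a : finAdelic (↥(maximalRealSubfield L)) L (IsCMField.complexConj L) 3 H) :
    frameChangePts Sc u K₂ (AlgPoints.map (Sc.Mc.map f) ((frameChangePts Sc u K₁).symm
        (ShimuraSet.mk L H τ (T * (u : GL (Fin 3) ℂ)) (formCongr_mul_U21 L H τ T hT u) K₁.1.1 y a))) =
      ShimuraSet.mk L H τ (T * (u : GL (Fin 3) ℂ)) (formCongr_mul_U21 L H τ T hT u) K₂.1.1 y a := by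
  rw [frameChangePts_symm_mk, frameChangePts_apply, Sc.map_pts, shimuraSetOfFrameChange_symm_mk, inv_smul_smul]

/-- (C2b) in the frame `T·u`: the `hol` witness of `Sc` at `(K, a)` serves VERBATIM — its value at `(T u)·(y,1) = c • T·(u•y, 1)` is its value at
`T·(u•y,1)` by its own homogeneity on the negative cone (`c = (u·(y,1))₃ ≠ 0`, ✔ `frame_mulVec_lift_mem_negCone`). [cite: SerreGAGA1956, §2]
[cite: Deligne1979ShimuraVarieties, 2.1.2–2.1.4] -/
theorem hol_frameChange (Sc : ComplexRecordSystem L H τ T hT K₀) (u : U21) (K : C5.SmallLevel K₀)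
    (a : finAdelic (↥(maximalRealSubfield L)) L (IsCMField.complexConj L) 3 H) :
    ∃ w : (Fin 3 → ℂ) → ComplexPoints (Sc.Mc.obj K),
      (∀ y : Ball, w ((((T * (u : GL (Fin 3) ℂ) : GL (Fin 3) ℂ)) : Matrix (Fin 3) (Fin 3) ℂ) *ᵥ BallModel.lift y) =
          (frameChangePts Sc u K).symm
            (ShimuraSet.mk L H τ (T * (u : GL (Fin 3) ℂ)) (formCongr_mul_U21 L H τ T hT u) K.1.1 y a)) ∧
      (∀ v ∈ negCone (H.map τ), ∀ c : ℂ, c ≠ 0 → w (c • v) = w v) ∧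
      ∀ (U : (Sc.Mc.obj K).left.affineOpens) (f : (Sc.Mc.obj K).left.presheaf.obj (Opposite.op (↑U : (Sc.Mc.obj K).left.Opens))),
        DifferentiableOn ℂ (fun v ↦ AlgPoints.evalOrZero (↑U : (Sc.Mc.obj K).left.Opens) f (w v))
          (negCone (H.map τ) ∩ w ⁻¹' {P | P.pt ∈ (↑U : (Sc.Mc.obj K).left.Opens)}) := by
  obtain ⟨w, h1, h2, h3⟩ := Sc.hol K a
  refine ⟨w, fun y => ?_, h2, h3⟩
  rw [frame_mul_mulVec_lift, h2 _ (frame_mulVec_lift_mem_negCone hT (u • y)) _ (W3_2_ne_zero u y), h1, frameChangePts_symm_mk]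

/-- (C2c) in the frame `T·u`: the pieces of `Sc` at `K` serve VERBATIM (same cofan, same ball data, same representatives) — the uniformisation
clause at `(T u)·(y,1) = c • T·(u•y,1)` by ✔ `unif_smul` on the cone of `H^τ`. [cite: Deligne1979ShimuraVarieties, 2.1.2] [cite: Milne2005ShimuraVarieties, Lemma 5.13 p. 57] -/
theorem pieces_frameChange (Sc : ComplexRecordSystem L H τ T hT K₀) (u : U21) (K : C5.SmallLevel K₀) :
    ∃ (g : orbitRel.Quotient (rational (↥(maximalRealSubfield L)) L (IsCMField.complexConj L) 3 H)
          (CosetSpace (rationalToFinAdelic (↥(maximalRealSubfield L)) L (IsCMField.complexConj L) 3 H) K.1.1) →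
        finAdelic (↥(maximalRealSubfield L)) L (IsCMField.complexConj L) 3 H)
      (_ : ∀ q, Quotient.mk'' (CosetSpace.pt (rationalToFinAdelic _ L _ 3 H) K.1.1 (g q)) = q)
      (X : orbitRel.Quotient (rational (↥(maximalRealSubfield L)) L (IsCMField.complexConj L) 3 H)
          (CosetSpace (rationalToFinAdelic (↥(maximalRealSubfield L)) L (IsCMField.complexConj L) 3 H) K.1.1) →
        SchemeOver ℂ)
      (ι : ∀ q, X q ⟶ Sc.Mc.obj K)
      (_ : IsColimit (Cofan.mk (Sc.Mc.obj K) ι))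
      (B : ∀ q, UnitaryBallUniformisationDatum 2 (X q)),
      ∀ q, (B q).Hℂ = H.map τ ∧
        (B q).Γ.map (Matrix.GeneralLinearGroup.map ((B q).τ₁ : ↥(B q).E →+* ℂ)) =
          (arithmeticLevel (↥(maximalRealSubfield L)) L (IsCMField.complexConj L) 3 H
            (K.1.1.map (MulAut.conj (g q)).toMonoidHom)).map (Matrix.GeneralLinearGroup.map τ) ∧
        ∀ y : Ball, AlgPoints.map (ι q)
            ((B q).unif ((((T * (u : GL (Fin 3) ℂ) : GL (Fin 3) ℂ)) : Matrix (Fin 3) (Fin 3) ℂ) *ᵥ BallModel.lift y)) =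
          (frameChangePts Sc u K).symm
            (ShimuraSet.mk L H τ (T * (u : GL (Fin 3) ℂ)) (formCongr_mul_U21 L H τ T hT u) K.1.1 y (g q)) := by
  obtain ⟨g, hg, X, ι, hcol, B, hB⟩ := Sc.pieces K
  refine ⟨g, hg, X, ι, hcol, B, fun q => ⟨(hB q).1, (hB q).2.1, fun y => ?_⟩⟩
  have hcone : (T : Matrix (Fin 3) (Fin 3) ℂ) *ᵥ BallModel.lift (u • y) ∈ (B q).cone := by
    change _ ∈ negCone (B q).Hℂ
    rw [(hB q).1]
    exact frame_mulVec_lift_mem_negCone hT (u • y)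
  rw [frame_mul_mulVec_lift, (B q).unif_smul (W3_2_ne_zero u y) hcone, (hB q).2.2 (u • y), frameChangePts_symm_mk]

/-- **The complex record system IN THE FRAME `T·u`**, as a structure literal: SAME complex models `Sc.Mc`, SAME smoothness/projectivity, `pts`
re-read through `[x, a] ↦ [u⁻¹ • x, a]`, `hol` and `pieces` verbatim up to the non-zero scalar `(u·(y,1))₃`.
[cite: Deligne1979ShimuraVarieties, 2.1.2–2.1.4 (PDF p. 24 of Milne's translation)] [cite: Milne2005ShimuraVarieties, Lemma 5.13 p. 57] -/
def ComplexRecordSystem.frameChange (Sc : ComplexRecordSystem L H τ T hT K₀) (u : U21) :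
    ComplexRecordSystem L H τ (T * (u : GL (Fin 3) ℂ)) (formCongr_mul_U21 L H τ T hT u) K₀ where
  Mc := Sc.Mc
  smooth := Sc.smooth
  projective := Sc.projective
  pts := frameChangePts Sc u
  map_pts := frameChangePts_map_pts Sc u
  hol := hol_frameChange Sc u
  pieces := pieces_frameChange Sc u

/-- The models of `frameChange Sc u` are those of `Sc` (by `rfl`). [folklore] -/
theorem ComplexRecordSystem.frameChange_Mc (Sc : ComplexRecordSystem L H τ T hT K₀) (u : U21) :
    (ComplexRecordSystem.frameChange Sc u).Mc = Sc.Mc :=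
  rfl

/-- **Point formula for `frameChange Sc u`** (by `rfl`): `((frameChange Sc u).pts K)⁻¹ [y, aK] = (Sc.pts K)⁻¹ [u • y, aK]`.
[cite: Milne2005ShimuraVarieties, Lemma 5.13 p. 57] -/
theorem ComplexRecordSystem.frameChange_pts_symm_mk (Sc : ComplexRecordSystem L H τ T hT K₀) (u : U21) (K : C5.SmallLevel K₀)
    (y : Ball) (a : finAdelic (↥(maximalRealSubfield L)) L (IsCMField.complexConj L) 3 H) :
    ((ComplexRecordSystem.frameChange Sc u).pts K).symm
        (ShimuraSet.mk L H τ (T * (u : GL (Fin 3) ℂ)) (formCongr_mul_U21 L H τ T hT u) K.1.1 y a) =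
      (Sc.pts K).symm (ShimuraSet.mk L H τ T hT K.1.1 (u • y) a) :=
  rfl

/-- **Point formula for the complex shadow of a record system `R` in the frame `T·u`** (by `rfl`), with the record's own `pts` and
`AlgPoints.baseChangeEquiv τ`. [cite: Deligne1979ShimuraVarieties, 2.2.5] -/
theorem ComplexRecordSystem.frameChange_pts_symm_mk_record (R : RecordSystem L H τ T hT K₀) (u : U21) (K : C5.SmallLevel K₀)
    (y : Ball) (a : finAdelic (↥(maximalRealSubfield L)) L (IsCMField.complexConj L) 3 H) :
    letI : Algebra L ℂ := τ.toAlgebra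
    ((ComplexRecordSystem.frameChange R.complexRecordSystem u).pts K).symm
        (ShimuraSet.mk L H τ (T * (u : GL (Fin 3) ℂ)) (formCongr_mul_U21 L H τ T hT u) K.1.1 y a) =
      AlgPoints.baseChangeEquiv τ (R.M.obj K) ((R.pts K).symm (ShimuraSet.mk L H τ T hT K.1.1 (u • y) a)) := by
  rw [ComplexRecordSystem.frameChange_pts_symm_mk]
  rfl

end ComplexFrame

/-! ## §3 The record system in the frame `T·u`: SAME models over `L` -/

section RecordFrame

variable {L : Type} [Field L] [NumberField L] [IsCMField L] {H : Matrix (Fin 3) (Fin 3) L}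
  {τ : L →+* ℂ} {T : GL (Fin 3) ℂ} {hT : formCongr (starRingEnd ℂ) T (H.map τ) = BallModel.J}
  {K₀ : C5.OpenCompactSubgroup ↥(finAdelic (↥(maximalRealSubfield L)) L (IsCMField.complexConj L) 3 H)}

/-- **(62) in the frame `T·u`**, read through `e := Iso.refl` and the points of `frameChange R_ℂ u` — the `recip` hypothesis of
✔ `recordSystem_exists_of_descent` at `(T·u, frameChange R_ℂ u, R.M, Iso.refl)`: the point is `(R.pts K)⁻¹ [u • y, aK]`, `u • y` is a line point of
`v₃` in the frame `T` (`isLinePoint_frameChange_iff`), and `R.recip` applies verbatim. [cite: Milne2005ShimuraVarieties, Def. 12.8 (62) p. 114]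
[cite: Deligne1979ShimuraVarieties, 2.2.4–2.2.5] -/
theorem recip_frameChange (R : RecordSystem L H τ T hT K₀) (u : U21) :
    letI : Algebra L ℂ := τ.toAlgebra
    ∀ (K : C5.SmallLevel K₀) (σ : ℂ ≃ₐ[L] ℂ) (s : (FiniteAdeleRing (𝓞 L) L)ˣ),
      IsArtinCorrespondent L τ s σ.toRingEquiv →
      ∀ (v₃ : Fin 3 → L) (x : Ball), IsLinePoint L τ (T * (u : GL (Fin 3) ℂ)) v₃ x →
        ∀ d : finAdelic (↥(maximalRealSubfield L)) L (IsCMField.complexConj L) 3 H,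
          IsDiagTwist L H v₃ (recipFactor L s) d →
          ∀ a : finAdelic (↥(maximalRealSubfield L)) L (IsCMField.complexConj L) 3 H,
            σ • (AlgPoints.baseChangeEquiv τ (R.M.obj K)).symm
                (AlgPoints.map ((Iso.refl (R.M ⋙ baseChangeHom τ)).inv.app K)
                  (((ComplexRecordSystem.frameChange R.complexRecordSystem u).pts K).symm
                    (ShimuraSet.mk L H τ (T * (u : GL (Fin 3) ℂ)) (formCongr_mul_U21 L H τ T hT u) K.1.1 x a))) =
              (AlgPoints.baseChangeEquiv τ (R.M.obj K)).symm
                (AlgPoints.map ((Iso.refl (R.M ⋙ baseChangeHom τ)).inv.app K)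
                  (((ComplexRecordSystem.frameChange R.complexRecordSystem u).pts K).symm
                    (ShimuraSet.mk L H τ (T * (u : GL (Fin 3) ℂ)) (formCongr_mul_U21 L H τ T hT u) K.1.1 x (d * a)))) := by
  letI : Algebra L ℂ := τ.toAlgebra
  intro K σ s hs v₃ x hx d hd a
  have hP : ∀ b : finAdelic (↥(maximalRealSubfield L)) L (IsCMField.complexConj L) 3 H,
      (AlgPoints.baseChangeEquiv τ (R.M.obj K)).symm
          (AlgPoints.map ((Iso.refl (R.M ⋙ baseChangeHom τ)).inv.app K)
            (((ComplexRecordSystem.frameChange R.complexRecordSystem u).pts K).symm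
              (ShimuraSet.mk L H τ (T * (u : GL (Fin 3) ℂ)) (formCongr_mul_U21 L H τ T hT u) K.1.1 x b))) =
        (R.pts K).symm (ShimuraSet.mk L H τ T hT K.1.1 (u • x) b) := by
    intro b
    have hid : ∀ P : ComplexPoints ((baseChangeHom τ).obj (R.M.obj K)),
        AlgPoints.map ((Iso.refl (R.M ⋙ baseChangeHom τ)).inv.app K) P = P := fun P => by
      apply Over.OverMorphism.ext
      rw [AlgPoints.map_apply, Over.comp_left, Iso.refl_inv, NatTrans.id_app, Over.id_left]
      exact Category.comp_id _
    rw [ComplexRecordSystem.frameChange_pts_symm_mk_record]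
    exact (congrArg (AlgPoints.baseChangeEquiv τ (R.M.obj K)).symm (hid _)).trans
      ((AlgPoints.baseChangeEquiv τ (R.M.obj K)).symm_apply_apply _)
  rw [hP a, hP (d * a)]
  exact R.recip K σ s hs v₃ (u • x) ((isLinePoint_frameChange_iff L τ T u v₃ x).1 hx) d hd a

/-- **Change of frame for Deligne's record systems, with the SAME models.**  For a record system `R` of `Sh(U(H), 𝔹²)` below `K₀` read at
`(τ, T)` and `u ∈ U(2,1)` there is a record system read at `(τ, T·u)` whose models ARE `R.M`: ✔ `recordSystem_exists_of_descent` at the complex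
record system `frameChange R_ℂ u` (§2), the form `Iso.refl`, and the reciprocity `recip_frameChange`.  (The canonical model does not depend on
the chosen Sylvester frame of `H^τ`: [Milne2005ShimuraVarieties] §12, the datum being `(G, X)`.)
[cite: Deligne1979ShimuraVarieties, 2.2.5 (PDF p. 29 of Milne's translation)] [cite: Milne2005ShimuraVarieties, §12 and Def. 12.8 (62) p. 114] -/
theorem RecordSystem.exists_frameChange (R : RecordSystem L H τ T hT K₀) (u : U21) :
    ∃ R' : RecordSystem L H τ (T * (u : GL (Fin 3) ℂ)) (formCongr_mul_U21 L H τ T hT u) K₀, R'.M = R.M :=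
  recordSystem_exists_of_descent (ComplexRecordSystem.frameChange R.complexRecordSystem u) R.M R.smooth R.projective
    (Iso.refl _) (recip_frameChange R u)

/-- **Change of frame, target form**: for ANY second frame `T'` of `H^τ` (`T'ᴴ H^τ T' = J`) a record system read at `(τ, T)` is re-read at
`(τ, T')` with the same models — `u := T⁻¹ T' ∈ U(J)`. [cite: Deligne1979ShimuraVarieties, 2.2.5] [cite: Milne2005ShimuraVarieties, §12] -/
theorem RecordSystem.exists_of_frame (R : RecordSystem L H τ T hT K₀) (T' : GL (Fin 3) ℂ)
    (hT' : formCongr (starRingEnd ℂ) T' (H.map τ) = BallModel.J) :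
    ∃ R' : RecordSystem L H τ T' hT' K₀, R'.M = R.M := by
  -- `u := T⁻¹ T'` preserves `J = Tᴴ H^τ T`: `uᴴ J u = T'ᴴ T⁻ᴴ Tᴴ H^τ T T⁻¹ T' = T'ᴴ H^τ T' = J`
  have hu : (((T⁻¹ * T' : GL (Fin 3) ℂ)) : Matrix (Fin 3) (Fin 3) ℂ)ᴴ * BallModel.J *
      (((T⁻¹ * T' : GL (Fin 3) ℂ)) : Matrix (Fin 3) (Fin 3) ℂ) = BallModel.J := by
    have h1 : formCongr (starRingEnd ℂ) (T⁻¹ * T') (formCongr (starRingEnd ℂ) T (H.map τ)) = BallModel.J := by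
      rw [formCongr_star, formCongr_star, Units.val_mul, Matrix.conjTranspose_mul]
      rw [formCongr_star] at hT'
      calc ((T' : GL (Fin 3) ℂ) : Matrix (Fin 3) (Fin 3) ℂ)ᴴ * ((T⁻¹ : GL (Fin 3) ℂ) : Matrix (Fin 3) (Fin 3) ℂ)ᴴ *
            ((T : Matrix (Fin 3) (Fin 3) ℂ)ᴴ * H.map τ * (T : Matrix (Fin 3) (Fin 3) ℂ)) *
            (((T⁻¹ : GL (Fin 3) ℂ) : Matrix (Fin 3) (Fin 3) ℂ) * (T' : Matrix (Fin 3) (Fin 3) ℂ))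
          = (T' : Matrix (Fin 3) (Fin 3) ℂ)ᴴ *
              ((((T⁻¹ : GL (Fin 3) ℂ) : Matrix (Fin 3) (Fin 3) ℂ)ᴴ * (T : Matrix (Fin 3) (Fin 3) ℂ)ᴴ) * H.map τ *
                ((T : Matrix (Fin 3) (Fin 3) ℂ) * ((T⁻¹ : GL (Fin 3) ℂ) : Matrix (Fin 3) (Fin 3) ℂ))) *
              (T' : Matrix (Fin 3) (Fin 3) ℂ) := by
            simp only [Matrix.mul_assoc]
        _ = BallModel.J := by
            rw [← Matrix.conjTranspose_mul, ← Units.val_mul, mul_inv_cancel, Units.val_one, Matrix.conjTranspose_one,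
              Matrix.one_mul, Matrix.mul_one]
            exact hT'
    rw [hT] at h1
    rw [formCongr_star] at h1
    exact h1
  obtain ⟨R₁, hM₁⟩ := RecordSystem.exists_frameChange R (mkU21 _ hu)
  have e : T * ((mkU21 _ hu : U21) : GL (Fin 3) ℂ) = T' := by
    refine Units.ext ?_
    rw [Units.val_mul]
    change (T : Matrix (Fin 3) (Fin 3) ℂ) * (((T⁻¹ * T' : GL (Fin 3) ℂ)) : Matrix (Fin 3) (Fin 3) ℂ) = _
    rw [← Units.val_mul, mul_inv_cancel_left]
  -- cast along the equality of frames (the frame index is a proof)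
  have cast : ∀ {T₁ : GL (Fin 3) ℂ} (_ : T₁ = T') (h₁ : formCongr (starRingEnd ℂ) T₁ (H.map τ) = BallModel.J),
      (∃ R₁ : RecordSystem L H τ T₁ h₁ K₀, R₁.M = R.M) → ∃ R' : RecordSystem L H τ T' hT' K₀, R'.M = R.M := by
    rintro _ rfl _ h
    exact h
  exact cast e _ ⟨R₁, hM₁⟩

end RecordFrame

end Summit.HodgeConjecture.CorCM.Model.RecordSystemConj

end
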